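import Summits.QuantumFields.YangMills.Theses.DirichletWindow

/-!
# `DirichletWindow.Assembly` — the assembly item of route `DirichletWindow`

Route `DirichletWindow` (sub-problem `YangMills` of summit `QuantumFields`) files, as its assembly
item `Assembly` (stmt-QuantumFields-12319), the implication chain

`FreeEnergyLogCoefficient → BoxLaplace → BackgroundBudget → WindowReduction → AxialLogConvexity →
 XiDivergesOfFixedDistance → CriticalityOfXiDiverges → LatticeGapLargeBeta →
 CriticalContinuumLimit → YangMills`.

Up to the order of the hypotheses `BoxLaplace` / `BackgroundBudget` this is the type of the route's
deciding theorem `Summit.QuantumFields.YangMills.Theses.DirichletWindow.closes` (planner-authored,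
sorry-free, kernel-checked with the route file). Its content is pure bookkeeping:
`WindowReduction` applied to the free-energy crux, the box Laplace lemma and the background budget
gives `LocalGaussianity = FixedDistanceLower ∧ PlaquetteVarianceUpper`; the chord glue
`XiDivergesOfFixedDistance` (with `AxialLogConvexity`) turns it into `XiDiverges`;
`CriticalityOfXiDiverges` produces the criticality clause of `CriticalContinuumLimit`, which together
with `LatticeGapLargeBeta` returns the witness clause of `YangMills` for every compact simple `G`.
This file closes the item by that composition; it adds no mathematics of its own.

Sources: route-internal (the deciding theorem `closes`); Jaffe–Witten 2000 for the clauses packaged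
in `YangMills`.
Deliberately NOT here: any of the cruxes (`FreeEnergyLogCoefficient`, `BackgroundBudget`,
`BoxLaplace`, `WindowReduction`, `LatticeGapLargeBeta`, `CriticalContinuumLimit`) or supports
(`AxialLogConvexity`, `XiDivergesOfFixedDistance`, `CriticalityOfXiDiverges`) — they stay open items
of the route.
-/

namespace Summit.QuantumFields.YangMills.Theorems

open Summit.QuantumFields.YangMills.Theses.DirichletWindow in
/-- **`DirichletWindow.Assembly` holds** (assembly item stmt-QuantumFields-12319): the chain
`FreeEnergyLogCoefficient → BoxLaplace → BackgroundBudget → WindowReduction → AxialLogConvexity →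
XiDivergesOfFixedDistance → CriticalityOfXiDiverges → LatticeGapLargeBeta → CriticalContinuumLimit →
YangMills`.
Proof: after unfolding and introducing the nine hypotheses, `WindowReduction` yields
`LocalGaussianity`, `XiDivergesOfFixedDistance` yields `XiDiverges`, and for each compact simple `G`
the conclusion of `CriticalContinuumLimit` is the `YangMills` clause, its two hypotheses being
supplied by `LatticeGapLargeBeta` and `CriticalityOfXiDiverges`. [folklore] -/
theorem dirichletWindow_assembly_proof :
    Summit.QuantumFields.YangMills.Theses.DirichletWindow.Assembly := by
  unfold Summit.QuantumFields.YangMills.Theses.DirichletWindow.Assembly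
  intro h2 h4 h3 h5 h9a h9b h9c h6 h7
  have hX : LocalGaussianity := h5 h2 h4 h3
  have hXi : XiDiverges := h9b h9a hX.1 hX.2
  intro G _ _ _ _ hG
  exact h7 G hG (fun r => h6 G hG r) (h9c hXi G hG)

end Summit.QuantumFields.YangMills.Theorems
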